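import Literature.NumberTheory.Automorphic.ShimuraCurveRibetTakahashiPeterssonTwoPowerLevelTwistProofs
import Literature.NumberTheory.EllipticCurves.NewformSymmSquareTwistClass
import Literature.NumberTheory.EllipticCurves.QuadraticTwistTwoLFunctionProofs
import HarnessLib

/-!
# Mai–Murty's bound `(f, f) ≪ N (log N)³` descends along quadratic twists: the levels `2ᵗM`
# whose twist by `−1`, `2` or `−2` has `64 ∤` level

Topic `NumberTheory/Automorphic`; namespace `Literature.NumberTheory.Automorphic` (with dot-notation
lemmas on `WeierstrassCurve` and on `IsNewformOf`). A proofs-only file (theorems only, no definition,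
no named fact; D-0026), continuing the work on the named fact `murty_petersson_newform_upper_bound` of
`ShimuraCurveRibetTakahashi.lean` (`‖f‖² ≪ N log N`, H. Pasten, *Shimura curves and the abc
conjecture*, arXiv:1705.09251, §16 p. 49, from [MaiMurty1994], [MurtyBounds]). As recorded on that
fact's docstring, the exponent `1` of `log N` is not what the cited proof gives: Mai–Murty 1994, §2
prove `L(1, Sym² f) = O((log N)³)` (Rademacher's Phragmén–Lindelöf), i.e. `(f, f) ≪ N (log N)³`. That
printed-strength statement is proved in the tree for every level `N = 2ᵗM`, `M` odd squarefree,
`t ≤ 5` (`exists_petersson_le_mul_log_cube_of_not_sixtyfour_dvd'`,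
`ShimuraCurveRibetTakahashiPeterssonTwoPowerLevelTwistProofs`; `t ≤ 3` unconditionally, `t = 4, 5`
given the newform of the twist `E^{(−1)}`). This file extends it to every such level **whose local
type at `2` becomes one of level `≤ 2⁵` after a twist by `χ₋₄`, `χ₈` or `χ₋₈`**, i.e. to every
elliptic curve `E/ℚ` with conductor `2ᵗM` (`M` odd squarefree) such that one of `E^{(−1)}`, `E^{(2)}`,
`E^{(−2)}` has conductor not divisible by `64` — for instance every `E` whose `2`-adic type is the
twist by `χ₈` or `χ₋₈` of a principal-series or special type of conductor `≤ 2` (these have `t = 6`),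
and more generally every twist by `−1`, `±2` of a curve already covered.

## The argument (a descent, not in the sources; each step is a cited theorem of the tree)

* **Comparison of Petersson norms across a quadratic twist (upper direction).** For the newforms
  `f` (level `N`) of `E` and `g` (level `N'`) of `E^{(d)}`, `d` squarefree, the tree's `GL₂`-side
  Rankin–Selberg identity `L_f(1) ρ_g = L_g(1) ρ_f` (`symmSqL_mul_prod_sqLocalFactor_eq`,
  `RankinSymmSquareTwistComparison`; `L_·(1) = 8π³ Re(·,·)/ψ(·)` at EVERY level, `symmSqL_one`,
  Rankin 1939; `ρ = ∏_{p ∣ NN'} E_p(·, 1)`, `E_p ∈ [1, 1 + 30/p]` by Hasse) gives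
  `ψ(N') Re(f,f) ≤ (∏_{p∣NN'}(1 + 30/p)) ψ(N) Re(g,g)`
  (`gamma0Index_mul_re_petersson_le_of_norm_cuspCoeff_eq`, for any twist-equivalent pair — the
  upper-bound companion of the tree's `twistEquiv_equiv_case`, Hoffstein–Lockhart 1994, proof of
  Thm. 0.1), and, since the twist is unramified at the odd primes `p ∤ d` whatever the reduction
  (`|a_{p^e}(E^{(d)})| = |a_{p^e}(E)|`, `localEulerFactor_quadraticTwist_intCast_of_not_dvd`), the
  local factors at those primes cancel: `ψ(N') Re(f,f) ≤ (∏_{p∣2d}(1 + 30/p)) ψ(N) Re(g,g)`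
  (`IsNewformOf.gamma0Index_mul_re_petersson_le_of_quadraticTwist`), `= 16 ψ(N) Re(g,g)` for
  `d ∈ {−1, ±2}`.
* **Levels.** `a_p(g) = χ(p) a_p(f)` at the odd primes with `χ = χ₄, χ₈, χ₈'` primitive quadratic of
  conductor `4, 8, 8` (`jacobiSym.at_two`, `jacobiSym.at_neg_two`), so by Atkin–Li in the tree's `lcm`
  form (`level_dvd_lcm_sq_of_charTwist_packet`) `N ∣ lcm(N', 64)` and `N' ∣ lcm(N, 64)`: the odd parts
  agree, `N' ≤ 64 N`, `ψ(N) ≤ 96 ψ(N')`; hence `Re(f,f) ≤ 1536 Re(g,g)`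
  (`IsNewformOf.re_petersson_le_of_quadraticTwist_mem`).
* **Descent.** If `64 ∤ N'`, the `t ≤ 5` theorem bounds `Re(g,g) ≤ C₀ N' (1 + log N')³`, and
  `1 + log N' ≤ (1 + log 64)(1 + log N)`:
  `exists_petersson_le_mul_log_cube_of_quadraticTwist_not_sixtyfour_dvd` (absolute constant), with its
  power form `C N^{1+ε}/ε³` and logarithmic form; and, supplying the newforms of the twists from the
  Modularity Theorem (`exists_isNewformOf` as a hypothesis),
  `exists_petersson_le_mul_log_cube_of_exists_isNewformOf`: the bound for every `E` with squarefree
  odd conductor such that `64 ∤ N_E` or `64 ∤ N_{E^{(d)}}` for some `d ∈ {−1, 2, −2}`.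

What is NOT covered (and is not claimed): conductors `2ᵗM` whose `2`-adic type keeps conductor
`≥ 2⁶` under every twist by `⟨χ₋₄, χ₈⟩` — this includes every type of conductor `2⁸` (for a character
`χ` of conductor `≤ 2³`, `a(π ⊗ χ) = a(π) = 8`) and the dihedral supercuspidal types of conductor `2⁷`;
there the Fourier expansions at the cusps `1/8`, `1/16` of `Γ₀(2ᵗM)` involve all three quadratic
twists at once, resp. twists by characters of conductor `16` (nebentypus), outside the tree. The named
fact itself (exponent `1`) is untouched: it is equivalent to `L^{naive}(1, Sym² f_E) ≪ log N_E`
(`murty_petersson_newform_upper_bound_iff_symmSqLOne`), for which no proof is known.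

## References

* L. Mai, M. R. Murty, *The Phragmén–Lindelöf theorem and modular elliptic curves*, Contemp. Math.
  166 (1994), §2, Proposition. [cite: MaiMurty1994, §2]
* H. Pasten, *Shimura curves and the abc conjecture*, J. Number Theory 254 (2024) / arXiv:1705.09251,
  §16 p. 49. [cite: PastenShimura2024, §16 p. 49]
* J. Hoffstein, P. Lockhart, *Coefficients of Maass forms and the Siegel zero*, Ann. of Math. 140
  (1994), proof of Thm. 0.1 (twist-equivalent case). [cite: HoffsteinLockhart1994, Thm. 0.1]
* R. A. Rankin, *Contributions to the theory of Ramanujan's function τ(n) … II*, Proc. Cambridge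
  Philos. Soc. 35 (1939), Thm. 3. [cite: Rankin1939, Thm. 3]
* A. O. L. Atkin, W. Li, *Twists of newforms and pseudo-eigenvalues of W-operators*, Invent. Math. 48
  (1978), §3. [cite: AtkinLi1978, §3]
* J. H. Silverman, *The Arithmetic of Elliptic Curves*, 2nd ed. (2009), X.2 Prop. 2.4, X.5 Cor. 5.4,
  Exercise 10.16 (coefficients of quadratic twists). [cite: SilvermanAEC2009, X.5 Cor. 5.4]

## Mathlib / tree search

Tree: `symmSqL_mul_prod_sqLocalFactor_eq`, `IsNewformOf.sqLocalFactor_ofReal`,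
`IsNewformOf.sqLocalFactor_one_le`, `twistEquiv_of_smul_eq_quadraticTwist`, `EllipticNewformIndex`
(`RankinSymmSquareTwistComparison`, `NewformSymmSquareTwistClass`); `symmSqL_one`, `exists_siegel_radius`
(`RankinSymmSquareGL2Fields`); `localEulerFactor_quadraticTwist_intCast_of_not_dvd`,
`χ₈_ringHomComp_apply_natCast`, `isPrimitive_χ₈_ringHomComp`, `isPrimitive_χ₈'_ringHomComp`,
`not_dvd_two_of_prime_ne_two` (`QuadraticTwistTwoLFunctionProofs`); `level_dvd_lcm_sq_of_charTwist_packet`,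
`IsNewformOf.level_dvd_lcm_sixteen_of_quadraticTwist_neg_one`,
`exists_petersson_le_mul_log_cube_of_not_sixtyfour_dvd'` (`…TwoPowerLevelTwistProofs`);
`gamma0Index_le_of_dvd`, `gamma0Index_sixteen_mul_le`, `mul_one_add_log_pow_three_le_rpow`
(`…TwistComparisonProofs`); `WeierstrassCurve.LFunction_apply_prime_pow` (`ModularityVersionAp`);
`exists_isNewformOf`, `WeierstrassCurve.conductorNorm_pos_holds`. Mathlib: `jacobiSym.at_two`,
`jacobiSym.at_neg_two`, `jacobiSym.eq_one_or_neg_one`, `PowerSeries.coeff_rescale`,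
`Finset.prod_filter_mul_prod_filter_not`, `Finset.prod_sdiff`, `Nat.exists_eq_two_pow_mul_odd`.
-/

noncomputable section

open scoped MatrixGroups ModularForm Real NumberTheorySymbols
open Complex CongruenceSubgroup Metric
open Literature.NumberTheory.EllipticCurves.ModularForms

/-! ### Dirichlet coefficients of a quadratic twist at the powers of an odd prime `ℓ ∤ d` -/

namespace WeierstrassCurve

open IsDedekindDomain IsDedekindDomain.HeightOneSpectrum NumberField Rat.HeightOneSpectrum
  ArithmeticFunction

variable (W : WeierstrassCurve ℚ) [W.IsElliptic]

/-- **`a_{ℓ^e}(E^{(d)}) = (d/ℓ)^e a_{ℓ^e}(E)` at an odd prime `ℓ ∤ d`** (`d ∈ ℤ`, all `e`), for Mathlib's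
`L`-function of the quadratic twist `E^{(d)}`: the local Euler factor of `E^{(d)}` at the place over
`ℓ` is that of `E` rescaled by the Legendre symbol `(d/ℓ)`
(`localEulerFactor_quadraticTwist_intCast_of_not_dvd`), whatever the reduction of `E` at `ℓ`; the
prime case is `LFunction_quadraticTwist_intCast_apply_prime_of_not_dvd`.
[cite: SilvermanAEC2009, X.2 Prop. 2.4 and Exercise 10.16] -/
theorem LFunction_quadraticTwist_intCast_apply_prime_pow_of_not_dvd (d : ℤ)
    (v : HeightOneSpectrum (𝓞 ℚ)) (hv2 : (primesEquiv v : ℕ) ≠ 2)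
    (hvd : ¬ ((primesEquiv v : ℕ) : ℤ) ∣ d) (e : ℕ) :
    (W.quadraticTwist (d : ℚ)).LFunction ((primesEquiv v : ℕ) ^ e) =
      J(d | (primesEquiv v : ℕ)) ^ e * W.LFunction ((primesEquiv v : ℕ) ^ e) := by
  have hℓ1 : 1 < (primesEquiv v : ℕ) := (primesEquiv v).2.one_lt
  have h1 := (W.quadraticTwist (d : ℚ)).LFunction_apply_prime_pow v e
  have h2 := W.LFunction_apply_prime_pow v e
  have key := congrArg (fun φ : ArithmeticFunction ℤ ↦ φ ((primesEquiv v : ℕ) ^ e))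
    (W.localEulerFactor_quadraticTwist_intCast_of_not_dvd d v hv2 hvd)
  simp only [localEulerFactor, natCard_residueField_adicCompletionIntegers] at key
  rw [ofPowerSeries_apply_pow hℓ1, ofPowerSeries_apply_pow hℓ1, PowerSeries.coeff_rescale] at key
  rw [h1, h2, key]

/-- **`|a_{p^e}(E^{(d)})| = |a_{p^e}(E)|` at an odd prime `p ∤ d`** (the Legendre symbol is `±1`).
[cite: SilvermanAEC2009, X.2 Prop. 2.4 and Exercise 10.16] -/
theorem abs_LFunction_quadraticTwist_intCast_prime_pow_of_not_dvd (d : ℤ) {p : ℕ} (hp : p.Prime)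
    (hp2 : p ≠ 2) (hpd : ¬ (p : ℤ) ∣ d) (e : ℕ) :
    |(W.quadraticTwist (d : ℚ)).LFunction (p ^ e)| = |W.LFunction (p ^ e)| := by
  obtain ⟨v, hv⟩ : ∃ v : HeightOneSpectrum (𝓞 ℚ), (primesEquiv v : ℕ) = p :=
    ⟨primesEquiv.symm ⟨p, hp⟩, by rw [Equiv.apply_symm_apply]⟩
  have hv2 : (primesEquiv v : ℕ) ≠ 2 := by rwa [hv]
  have hvd : ¬ ((primesEquiv v : ℕ) : ℤ) ∣ d := by rwa [hv]
  have key := W.LFunction_quadraticTwist_intCast_apply_prime_pow_of_not_dvd d v hv2 hvd e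
  rw [hv] at key
  have hg : d.gcd p = 1 := by
    have hodd : ¬ p ∣ d.natAbs := fun h ↦ hpd (Int.ofNat_dvd_left.mpr h)
    change d.natAbs.gcd ((p : ℤ)).natAbs = 1
    rw [Int.natAbs_natCast]
    exact ((Nat.Prime.coprime_iff_not_dvd hp).mpr hodd).symm
  rw [key, abs_mul, abs_pow]
  rcases jacobiSym.eq_one_or_neg_one hg with h | h <;> simp [h]

end WeierstrassCurve

namespace Literature.NumberTheory.Automorphic

/-! ### Coefficients of the newform of a quadratic twist -/

section TwistCoeff

open _root_.WeierstrassCurve _root_.IsDedekindDomain _root_.NumberField Rat.HeightOneSpectrum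

variable {N N' : ℕ} [NeZero N] [NeZero N'] {W : WeierstrassCurve ℚ} [W.IsElliptic]

/-- **`|a_{p^e}(g)| = |a_{p^e}(f)|` at every odd prime `p ∤ d`**, for the newform `f` of `E` and the
newform `g` of the twist `E^{(d)}` (`IsNewformOf` pins the coefficients to the Dirichlet coefficients
of the curves). [cite: SilvermanAEC2009, X.2 Prop. 2.4 and Exercise 10.16] -/
theorem _root_.Literature.NumberTheory.EllipticCurves.ModularForms.IsNewformOf.norm_cuspCoeff_prime_pow_eq_of_quadraticTwist {d : ℤ} {f : CuspForm (Gamma0 N) 2}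
    {g : CuspForm (Gamma0 N') 2} (hf : IsNewformOf W f) (hg : IsNewformOf (W.quadraticTwist (d : ℚ)) g)
    {p : ℕ} (hp : p.Prime) (hp2 : p ≠ 2) (hpd : ¬ (p : ℤ) ∣ d) (e : ℕ) :
    ‖cuspCoeff g (p ^ e)‖ = ‖cuspCoeff f (p ^ e)‖ := by
  rw [hg.2 (p ^ e), hf.2 (p ^ e), Complex.norm_intCast, Complex.norm_intCast, ← Int.cast_abs,
    ← Int.cast_abs, W.abs_LFunction_quadraticTwist_intCast_prime_pow_of_not_dvd d hp hp2 hpd e]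

/-- **`a_p(g) = χ₈(p) a_p(f)` at the odd primes**, for the newform `g` of `E^{(2)}` (Kronecker
character `(8/·) = χ₈`; `(2/p) = χ₈(p)`, `jacobiSym.at_two`).
[cite: SilvermanAEC2009, X.5 Cor. 5.4 and Exercise 10.16] -/
theorem _root_.Literature.NumberTheory.EllipticCurves.ModularForms.IsNewformOf.cuspCoeff_prime_eq_χ₈_mul {f : CuspForm (Gamma0 N) 2} {g : CuspForm (Gamma0 N') 2}
    (hf : IsNewformOf W f) (hg : IsNewformOf (W.quadraticTwist 2) g)
    (p : ℕ) (hp : p.Prime) (hp2 : ¬ p ∣ 2) :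
    cuspCoeff g p = (ZMod.χ₈.ringHomComp (Int.castRingHom ℂ)) p * cuspCoeff f p := by
  have hp2' : p ≠ 2 := fun h ↦ hp2 (h ▸ dvd_rfl)
  have hodd : Odd p := hp.odd_of_ne_two hp2'
  obtain ⟨v, hv⟩ : ∃ v : HeightOneSpectrum (𝓞 ℚ), (primesEquiv v : ℕ) = p :=
    ⟨primesEquiv.symm ⟨p, hp⟩, by rw [Equiv.apply_symm_apply]⟩
  have hv2 : (primesEquiv v : ℕ) ≠ 2 := by rwa [hv]
  have hvd : ¬ ((primesEquiv v : ℕ) : ℤ) ∣ 2 := by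
    rw [hv]; exact not_dvd_two_of_prime_ne_two hp hp2'
  have key := W.LFunction_quadraticTwist_intCast_apply_prime_pow_of_not_dvd 2 v hv2 hvd 1
  rw [hv, pow_one, pow_one, jacobiSym.at_two hodd, show ((2 : ℤ) : ℚ) = 2 by norm_num] at key
  rw [hg.2 p, hf.2 p, key, Int.cast_mul, χ₈_ringHomComp_apply_natCast]

/-- **`a_p(g) = χ₈'(p) a_p(f)` at the odd primes**, for the newform `g` of `E^{(−2)}` (Kronecker
character `(−8/·) = χ₈'`; `(−2/p) = χ₈'(p)`, `jacobiSym.at_neg_two`).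
[cite: SilvermanAEC2009, X.5 Cor. 5.4 and Exercise 10.16] -/
theorem _root_.Literature.NumberTheory.EllipticCurves.ModularForms.IsNewformOf.cuspCoeff_prime_eq_χ₈'_mul {f : CuspForm (Gamma0 N) 2} {g : CuspForm (Gamma0 N') 2}
    (hf : IsNewformOf W f) (hg : IsNewformOf (W.quadraticTwist (-2)) g)
    (p : ℕ) (hp : p.Prime) (hp2 : ¬ p ∣ 2) :
    cuspCoeff g p = (ZMod.χ₈'.ringHomComp (Int.castRingHom ℂ)) p * cuspCoeff f p := by
  have hp2' : p ≠ 2 := fun h ↦ hp2 (h ▸ dvd_rfl)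
  have hodd : Odd p := hp.odd_of_ne_two hp2'
  obtain ⟨v, hv⟩ : ∃ v : HeightOneSpectrum (𝓞 ℚ), (primesEquiv v : ℕ) = p :=
    ⟨primesEquiv.symm ⟨p, hp⟩, by rw [Equiv.apply_symm_apply]⟩
  have hv2 : (primesEquiv v : ℕ) ≠ 2 := by rwa [hv]
  have hvd : ¬ ((primesEquiv v : ℕ) : ℤ) ∣ (-2) := by
    rw [hv, dvd_neg]; exact not_dvd_two_of_prime_ne_two hp hp2'
  have key := W.LFunction_quadraticTwist_intCast_apply_prime_pow_of_not_dvd (-2) v hv2 hvd 1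
  rw [hv, pow_one, pow_one, jacobiSym.at_neg_two hodd, show ((-2 : ℤ) : ℚ) = -2 by norm_num] at key
  rw [hg.2 p, hf.2 p, key, Int.cast_mul, χ₈'_ringHomComp_apply_natCast]

end TwistCoeff

/-! ### The comparison of Petersson norms of twist-equivalent elliptic newforms (upper direction) -/

section Comparison

variable {N N' : ℕ} [NeZero N] [NeZero N'] {W W' : WeierstrassCurve ℚ} [W.IsElliptic] [W'.IsElliptic]

/-- **Upper comparison of Petersson norms across twist-equivalence.**  Let `f ∈ S₂(Γ₀(N))`,
`g ∈ S₂(Γ₀(N'))` be the newforms of two elliptic curves over `ℚ` with `|a_p(f)| = |a_p(g)|` at every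
prime `p ∤ NN'`.  Then
`ψ(N') · Re (f, f)_{Γ₀(N)} ≤ (∏_{p ∣ NN'} (1 + 30/p)) · ψ(N) · Re (g, g)_{Γ₀(N')}`,
`ψ = gamma0Index = [SL₂(ℤ) : Γ₀(·)]`.  Proof: the tree's Rankin–Selberg identity on the `GL₂` side
`L_f(1) ρ_g = L_g(1) ρ_f` (`symmSqL_mul_prod_sqLocalFactor_eq` at `s = 1`, the Euler products agreeing
off `NN'`), with `ρ = ∏_{p∣NN'} E_p(·, 1)`, `E_p(·,1) = Σ_e |a_{p^e}|² p^{−2e} ∈ [1, 1 + 30/p]`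
(`IsNewformOf.sqLocalFactor_ofReal`, `IsNewformOf.sqLocalFactor_one_le`) and
`L_·(1) = 8π³ Re(·,·)/ψ(·)` (`symmSqL_one`, Rankin 1939: the residue of the Rankin–Selberg
convolution at the edge, at every level).  This is the upper-bound companion of the tree's
`twistEquiv_equiv_case` (Hoffstein–Lockhart 1994, proof of Thm. 0.1, twist-equivalent case).
[cite: HoffsteinLockhart1994, Thm. 0.1 (proof, the twist-equivalent case)] [cite: Rankin1939, Thm. 3] -/
theorem gamma0Index_mul_re_petersson_le_of_norm_cuspCoeff_eq {f : CuspForm (Gamma0 N) 2}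
    {g : CuspForm (Gamma0 N') 2} (hf : IsNewformOf W f) (hg : IsNewformOf W' g)
    (h : ∀ p : ℕ, p.Prime → ¬ p ∣ N * N' → ‖cuspCoeff f p‖ = ‖cuspCoeff g p‖) :
    (gamma0Index N' : ℝ) * (peterssonProduct (Gamma0 N) 2 f f).re ≤
      (∏ p ∈ (N * N').primeFactors, (1 + 30 / (p : ℝ))) * gamma0Index N *
        (peterssonProduct (Gamma0 N') 2 g g).re := by
  obtain ⟨r, hr0, -, hr⟩ := exists_siegel_radius
  have hprime : ∀ p ∈ (N * N').primeFactors, p.Prime := fun p hp ↦ Nat.prime_of_mem_primeFactors hp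
  -- the identity at `s = 1`
  have h1mem : (1 : ℂ) ∈ ball (2 : ℂ) (1 + 2 * r) := by
    rw [mem_ball, dist_eq_norm, show (1 : ℂ) - 2 = -1 by norm_num, norm_neg, norm_one]
    linarith
  have hEq := symmSqL_mul_prod_sqLocalFactor_eq hf hg h hr0.le hr h1mem
  simp only [] at hEq
  -- real values of the local factors at `1`
  set Ef : ℕ → ℝ := fun p ↦
    ∑' e : ℕ, ‖cuspCoeff f (p ^ e)‖ ^ 2 * ((p : ℝ) ^ (-(1 + 1 : ℝ))) ^ e with hEfdef
  set Eg : ℕ → ℝ := fun p ↦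
    ∑' e : ℕ, ‖cuspCoeff g (p ^ e)‖ ^ 2 * ((p : ℝ) ^ (-(1 + 1 : ℝ))) ^ e with hEgdef
  have hEf : ∀ {p : ℕ}, p.Prime → sqLocalFactor f p 1 = ((Ef p : ℝ) : ℂ) ∧ 1 ≤ Ef p := by
    intro p hp
    have h := hf.sqLocalFactor_ofReal hp (σ := 1) one_pos
    rw [Complex.ofReal_one] at h
    exact h
  have hEg : ∀ {p : ℕ}, p.Prime → sqLocalFactor g p 1 = ((Eg p : ℝ) : ℂ) ∧ 1 ≤ Eg p := by
    intro p hp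
    have h := hg.sqLocalFactor_ofReal hp (σ := 1) one_pos
    rw [Complex.ofReal_one] at h
    exact h
  set ρf : ℝ := ∏ p ∈ (N * N').primeFactors, Ef p with hρfdef
  set ρg : ℝ := ∏ p ∈ (N * N').primeFactors, Eg p with hρgdef
  have hρfval : ∏ p ∈ (N * N').primeFactors, sqLocalFactor f p 1 = ((ρf : ℝ) : ℂ) := by
    rw [hρfdef, Complex.ofReal_prod]
    exact Finset.prod_congr rfl fun p hp ↦ (hEf (hprime p hp)).1
  have hρgval : ∏ p ∈ (N * N').primeFactors, sqLocalFactor g p 1 = ((ρg : ℝ) : ℂ) := by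
    rw [hρgdef, Complex.ofReal_prod]
    exact Finset.prod_congr rfl fun p hp ↦ (hEg (hprime p hp)).1
  have hρg1 : 1 ≤ ρg := Finset.one_le_prod fun p hp ↦ (hEg (hprime p hp)).2
  set B : ℝ := ∏ p ∈ (N * N').primeFactors, (1 + 30 / (p : ℝ)) with hBdef
  have hρfB : ρf ≤ B := by
    refine Finset.prod_le_prod (fun p hp ↦ zero_le_one.trans (hEf (hprime p hp)).2) fun p hp ↦ ?_
    exact hf.sqLocalFactor_one_le (hprime p hp)
  -- the values `L(1)` as real numbers
  set Pf : ℝ := (peterssonProduct (Gamma0 N) 2 f f).re with hPfdef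
  set Pg : ℝ := (peterssonProduct (Gamma0 N') 2 g g).re with hPgdef
  have hPf0 : 0 < Pf := hf.peterssonProduct_re_pos
  have hPg0 : 0 < Pg := hg.peterssonProduct_re_pos
  have hψN : (0 : ℝ) < gamma0Index N := Nat.cast_pos.mpr (gamma0Index_pos N)
  have hψN' : (0 : ℝ) < gamma0Index N' := Nat.cast_pos.mpr (gamma0Index_pos N')
  set a : ℝ := 8 * π ^ 3 * Pf / gamma0Index N with hadef
  set b : ℝ := 8 * π ^ 3 * Pg / gamma0Index N' with hbdef
  have ha0 : 0 ≤ a := by positivity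
  have hb0 : 0 ≤ b := by positivity
  rw [hρfval, hρgval, symmSqL_one f, symmSqL_one g] at hEq
  have hre : a * ρg = b * ρf := by
    have := congrArg Complex.re hEq
    simpa only [Complex.re_mul_ofReal, Complex.ofReal_re, ← hPfdef, ← hPgdef, ← hadef, ← hbdef]
      using this
  -- `a ≤ a ρ_g = b ρ_f ≤ b B`
  have hab : a ≤ B * b := by
    calc a ≤ a * ρg := le_mul_of_one_le_right ha0 hρg1
      _ = b * ρf := hre
      _ ≤ b * B := by gcongr
      _ = B * b := mul_comm _ _
  -- unwind `a`, `b`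
  have hPf : Pf = a * gamma0Index N / (8 * π ^ 3) := by
    rw [hadef]; field_simp
  have hPg : Pg = b * gamma0Index N' / (8 * π ^ 3) := by
    rw [hbdef]; field_simp
  calc (gamma0Index N' : ℝ) * Pf
      = gamma0Index N' * (a * gamma0Index N / (8 * π ^ 3)) := by rw [hPf]
    _ ≤ gamma0Index N' * ((B * b) * gamma0Index N / (8 * π ^ 3)) := by gcongr
    _ = B * gamma0Index N * (b * gamma0Index N' / (8 * π ^ 3)) := by ring
    _ = B * gamma0Index N * Pg := by rw [← hPg]

/-- **The newforms of `E` and of a quadratic twist `E^{(d)}` are twist-equivalent**: for `d ≠ 0`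
squarefree, `|a_p(f)| = |a_p(g)|` at every prime `p ∤ NN'` (the tree's
`twistEquiv_of_smul_eq_quadraticTwist`, Hoffstein–Lockhart's twist-equivalent case, read for the pair
of indices `(N, E, f)`, `(N', E^{(d)}, g)`). [cite: HoffsteinLockhart1994, Thm. 0.1 (proof, the twist-equivalent case)] -/
theorem _root_.Literature.NumberTheory.EllipticCurves.ModularForms.IsNewformOf.norm_cuspCoeff_eq_of_quadraticTwist {d : ℤ} (hd0 : d ≠ 0) (hsq : Squarefree d)
    {f : CuspForm (Gamma0 N) 2} {g : CuspForm (Gamma0 N') 2} (hf : IsNewformOf W f)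
    (hg : IsNewformOf (W.quadraticTwist (d : ℚ)) g) :
    ∀ p : ℕ, p.Prime → ¬ p ∣ N * N' → ‖cuspCoeff f p‖ = ‖cuspCoeff g p‖ := by
  have hd0' : (d : ℚ) ≠ 0 := by exact_mod_cast hd0
  haveI := W.isElliptic_quadraticTwist hd0'
  exact twistEquiv_of_smul_eq_quadraticTwist (i := ⟨N, W, f, hf⟩)
    (j := ⟨N', W.quadraticTwist (d : ℚ), g, hg⟩) hd0 hsq
    (C := (1 : WeierstrassCurve.VariableChange ℚ)) (one_smul _ _)

/-- **Comparison of Petersson norms across a quadratic twist, with a constant depending only on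
`d`.**  For the newform `f ∈ S₂(Γ₀(N))` of `E/ℚ` and the newform `g ∈ S₂(Γ₀(N'))` of a quadratic twist
`E^{(d)}` (`d ≠ 0` squarefree):
`ψ(N') · Re (f, f)_{Γ₀(N)} ≤ (∏_{p ∣ 2d} (1 + 30/p)) · ψ(N) · Re (g, g)_{Γ₀(N')}`.
Refines `gamma0Index_mul_re_petersson_le_of_norm_cuspCoeff_eq`: at an odd prime `p ∤ d` dividing
`NN'` the local factors `E_p(f, 1)`, `E_p(g, 1)` of the two Rankin–Selberg series coincide
(`|a_{p^e}(g)| = |a_{p^e}(f)|`, `IsNewformOf.norm_cuspCoeff_prime_pow_eq_of_quadraticTwist`: the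
twist is unramified at `p` whatever the reduction), so they cancel in `L_f(1) ρ_g = L_g(1) ρ_f` and only
the primes of `2d` remain. For `d ∈ {−1, ±2}` the constant is `1 + 30/2 = 16`.
[cite: HoffsteinLockhart1994, Thm. 0.1 (proof, the twist-equivalent case)] [cite: Rankin1939, Thm. 3] -/
theorem _root_.Literature.NumberTheory.EllipticCurves.ModularForms.IsNewformOf.gamma0Index_mul_re_petersson_le_of_quadraticTwist {d : ℤ} (hd0 : d ≠ 0)
    (hsq : Squarefree d) {f : CuspForm (Gamma0 N) 2} {g : CuspForm (Gamma0 N') 2}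
    (hf : IsNewformOf W f) (hg : IsNewformOf (W.quadraticTwist (d : ℚ)) g) :
    (gamma0Index N' : ℝ) * (peterssonProduct (Gamma0 N) 2 f f).re ≤
      (∏ p ∈ (2 * d.natAbs).primeFactors, (1 + 30 / (p : ℝ))) * gamma0Index N *
        (peterssonProduct (Gamma0 N') 2 g g).re := by
  have hd0' : (d : ℚ) ≠ 0 := by exact_mod_cast hd0
  haveI := W.isElliptic_quadraticTwist hd0'
  have h := hf.norm_cuspCoeff_eq_of_quadraticTwist hd0 hsq hg
  obtain ⟨r, hr0, -, hr⟩ := exists_siegel_radius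
  have hprime : ∀ p ∈ (N * N').primeFactors, p.Prime := fun p hp ↦ Nat.prime_of_mem_primeFactors hp
  -- the identity at `s = 1`
  have h1mem : (1 : ℂ) ∈ ball (2 : ℂ) (1 + 2 * r) := by
    rw [mem_ball, dist_eq_norm, show (1 : ℂ) - 2 = -1 by norm_num, norm_neg, norm_one]
    linarith
  have hEq := symmSqL_mul_prod_sqLocalFactor_eq hf hg h hr0.le hr h1mem
  simp only [] at hEq
  -- real values of the local factors at `1`
  set Ef : ℕ → ℝ := fun p ↦
    ∑' e : ℕ, ‖cuspCoeff f (p ^ e)‖ ^ 2 * ((p : ℝ) ^ (-(1 + 1 : ℝ))) ^ e with hEfdef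
  set Eg : ℕ → ℝ := fun p ↦
    ∑' e : ℕ, ‖cuspCoeff g (p ^ e)‖ ^ 2 * ((p : ℝ) ^ (-(1 + 1 : ℝ))) ^ e with hEgdef
  have hEf : ∀ {p : ℕ}, p.Prime → sqLocalFactor f p 1 = ((Ef p : ℝ) : ℂ) ∧ 1 ≤ Ef p := by
    intro p hp
    have h := hf.sqLocalFactor_ofReal hp (σ := 1) one_pos
    rw [Complex.ofReal_one] at h
    exact h
  have hEg : ∀ {p : ℕ}, p.Prime → sqLocalFactor g p 1 = ((Eg p : ℝ) : ℂ) ∧ 1 ≤ Eg p := by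
    intro p hp
    have h := hg.sqLocalFactor_ofReal hp (σ := 1) one_pos
    rw [Complex.ofReal_one] at h
    exact h
  -- at the odd primes `p ∤ d` the local factors coincide
  have hEfg : ∀ {p : ℕ}, p.Prime → ¬ p ∣ 2 * d.natAbs → Ef p = Eg p := by
    intro p hp hpd
    have hp2 : p ≠ 2 := by
      rintro rfl
      exact hpd (dvd_mul_right 2 _)
    have hpd' : ¬ (p : ℤ) ∣ d := fun h' ↦ hpd (dvd_mul_of_dvd_right (Int.ofNat_dvd_left.mp h') 2)
    simp only [hEfdef, hEgdef]
    exact tsum_congr fun e ↦ by rw [hf.norm_cuspCoeff_prime_pow_eq_of_quadraticTwist hg hp hp2 hpd' e]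
  set S := (N * N').primeFactors with hSdef
  set S₁ := S.filter (fun p ↦ p ∣ 2 * d.natAbs) with hS₁def
  set S₂ := S.filter (fun p ↦ ¬ p ∣ 2 * d.natAbs) with hS₂def
  set ρf : ℝ := ∏ p ∈ S, Ef p with hρfdef
  set ρg : ℝ := ∏ p ∈ S, Eg p with hρgdef
  set ρf₁ : ℝ := ∏ p ∈ S₁, Ef p with hρf₁def
  set ρg₁ : ℝ := ∏ p ∈ S₁, Eg p with hρg₁def
  set c : ℝ := ∏ p ∈ S₂, Ef p with hcdef
  have hρf_split : ρf = ρf₁ * c := by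
    rw [hρfdef, hρf₁def, hcdef, hS₁def, hS₂def, Finset.prod_filter_mul_prod_filter_not]
  have hρg_split : ρg = ρg₁ * c := by
    rw [hρgdef, hρg₁def, hcdef, hS₁def, hS₂def, ← Finset.prod_filter_mul_prod_filter_not S
      (fun p ↦ p ∣ 2 * d.natAbs)]
    congr 1
    refine Finset.prod_congr rfl fun p hp ↦ ?_
    rw [Finset.mem_filter] at hp
    exact (hEfg (hprime p hp.1) hp.2).symm
  have hc0 : 0 < c := Finset.prod_pos fun p hp ↦
    zero_lt_one.trans_le (hEf (hprime p (Finset.mem_filter.mp hp).1)).2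
  have hρfval : ∏ p ∈ (N * N').primeFactors, sqLocalFactor f p 1 = ((ρf : ℝ) : ℂ) := by
    rw [hρfdef, Complex.ofReal_prod]
    exact Finset.prod_congr rfl fun p hp ↦ (hEf (hprime p hp)).1
  have hρgval : ∏ p ∈ (N * N').primeFactors, sqLocalFactor g p 1 = ((ρg : ℝ) : ℂ) := by
    rw [hρgdef, Complex.ofReal_prod]
    exact Finset.prod_congr rfl fun p hp ↦ (hEg (hprime p hp)).1
  have hρg₁1 : 1 ≤ ρg₁ := Finset.one_le_prod fun p hp ↦ (hEg (hprime p (Finset.mem_filter.mp hp).1)).2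
  set B : ℝ := ∏ p ∈ (2 * d.natAbs).primeFactors, (1 + 30 / (p : ℝ)) with hBdef
  have hρf₁B : ρf₁ ≤ B := by
    have hsub : S₁ ⊆ (2 * d.natAbs).primeFactors := by
      intro p hp
      rw [Finset.mem_filter] at hp
      exact Nat.mem_primeFactors.mpr ⟨hprime p hp.1, hp.2,
        mul_ne_zero two_ne_zero (Int.natAbs_ne_zero.mpr hd0)⟩
    calc ρf₁ ≤ ∏ p ∈ S₁, (1 + 30 / (p : ℝ)) := by
          refine Finset.prod_le_prod (fun p hp ↦ zero_le_one.trans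
            (hEf (hprime p (Finset.mem_filter.mp hp).1)).2) fun p hp ↦ ?_
          exact hf.sqLocalFactor_one_le (hprime p (Finset.mem_filter.mp hp).1)
      _ ≤ B := by
          rw [hBdef, ← Finset.prod_sdiff hsub]
          refine le_mul_of_one_le_left (Finset.prod_nonneg fun p _ ↦ ?_)
            (Finset.one_le_prod fun p _ ↦ ?_)
          · have : (0 : ℝ) ≤ 30 / p := by positivity
            linarith
          · have : (0 : ℝ) ≤ 30 / p := by positivity
            linarith
  -- the values `L(1)` as real numbers
  set Pf : ℝ := (peterssonProduct (Gamma0 N) 2 f f).re with hPfdef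
  set Pg : ℝ := (peterssonProduct (Gamma0 N') 2 g g).re with hPgdef
  have hPf0 : 0 < Pf := hf.peterssonProduct_re_pos
  have hPg0 : 0 < Pg := hg.peterssonProduct_re_pos
  have hψN : (0 : ℝ) < gamma0Index N := Nat.cast_pos.mpr (gamma0Index_pos N)
  have hψN' : (0 : ℝ) < gamma0Index N' := Nat.cast_pos.mpr (gamma0Index_pos N')
  set a : ℝ := 8 * π ^ 3 * Pf / gamma0Index N with hadef
  set b : ℝ := 8 * π ^ 3 * Pg / gamma0Index N' with hbdef
  have ha0 : 0 ≤ a := by positivity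
  have hb0 : 0 ≤ b := by positivity
  rw [hρfval, hρgval, symmSqL_one f, symmSqL_one g] at hEq
  have hre : a * ρg = b * ρf := by
    have := congrArg Complex.re hEq
    simpa only [Complex.re_mul_ofReal, Complex.ofReal_re, ← hPfdef, ← hPgdef, ← hadef, ← hbdef]
      using this
  -- cancel the common odd part `c`
  have hre₁ : a * ρg₁ = b * ρf₁ := by
    rw [hρf_split, hρg_split, ← mul_assoc, ← mul_assoc] at hre
    exact mul_right_cancel₀ hc0.ne' hre
  -- `a ≤ a ρ_g₁ = b ρ_f₁ ≤ b B`
  have hab : a ≤ B * b := by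
    calc a ≤ a * ρg₁ := le_mul_of_one_le_right ha0 hρg₁1
      _ = b * ρf₁ := hre₁
      _ ≤ b * B := by gcongr
      _ = B * b := mul_comm _ _
  have hPf : Pf = a * gamma0Index N / (8 * π ^ 3) := by
    rw [hadef]; field_simp
  have hPg : Pg = b * gamma0Index N' / (8 * π ^ 3) := by
    rw [hbdef]; field_simp
  calc (gamma0Index N' : ℝ) * Pf
      = gamma0Index N' * (a * gamma0Index N / (8 * π ^ 3)) := by rw [hPf]
    _ ≤ gamma0Index N' * ((B * b) * gamma0Index N / (8 * π ^ 3)) := by gcongr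
    _ = B * gamma0Index N * (b * gamma0Index N' / (8 * π ^ 3)) := by ring
    _ = B * gamma0Index N * Pg := by rw [← hPg]

/-- The constant of `IsNewformOf.gamma0Index_mul_re_petersson_le_of_quadraticTwist` for
`d ∈ {−1, 2, −2}`: `∏_{p ∣ 2d} (1 + 30/p) = 16`. [folklore] -/
theorem prod_primeFactors_two_mul_natAbs_eq_sixteen {d : ℤ} (hd : d = -1 ∨ d = 2 ∨ d = -2) :
    ∏ p ∈ (2 * d.natAbs).primeFactors, (1 + 30 / (p : ℝ)) = 16 := by
  have h4 : (2 * 2 : ℕ).primeFactors = {2} := by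
    rw [show (2 * 2 : ℕ) = 2 ^ 2 by norm_num, Nat.primeFactors_prime_pow two_ne_zero Nat.prime_two]
  rcases hd with rfl | rfl | rfl
  · simp; norm_num
  · rw [show (2 : ℤ).natAbs = 2 by rfl, h4, Finset.prod_singleton]; norm_num
  · rw [show (-2 : ℤ).natAbs = 2 by rfl, h4, Finset.prod_singleton]; norm_num

/-- **`ψ(N') Re (f, f) ≤ 16 ψ(N) Re (g, g)`** for the newform `g` of the twist of `E` by
`d ∈ {−1, 2, −2}`. [cite: HoffsteinLockhart1994, Thm. 0.1 (proof, the twist-equivalent case)] -/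
theorem _root_.Literature.NumberTheory.EllipticCurves.ModularForms.IsNewformOf.gamma0Index_mul_re_petersson_le_sixteen_mul {d : ℤ} (hd : d = -1 ∨ d = 2 ∨ d = -2)
    {f : CuspForm (Gamma0 N) 2} {g : CuspForm (Gamma0 N') 2}
    (hf : IsNewformOf W f) (hg : IsNewformOf (W.quadraticTwist (d : ℚ)) g) :
    (gamma0Index N' : ℝ) * (peterssonProduct (Gamma0 N) 2 f f).re ≤
      16 * gamma0Index N * (peterssonProduct (Gamma0 N') 2 g g).re := by
  have hd0 : d ≠ 0 := by rcases hd with rfl | rfl | rfl <;> norm_num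
  have hsq : Squarefree d := by
    rcases hd with rfl | rfl | rfl
    · exact isUnit_one.neg.squarefree
    · exact Int.prime_two.squarefree
    · exact Int.prime_two.neg.squarefree
  have h := hf.gamma0Index_mul_re_petersson_le_of_quadraticTwist hd0 hsq hg
  rwa [prod_primeFactors_two_mul_natAbs_eq_sixteen hd] at h

end Comparison

/-! ### The levels of the newforms of `E` and `E^{(±2)}`; the index `ψ` -/

section Level

variable {N N' : ℕ} [NeZero N] [NeZero N'] {W : WeierstrassCurve ℚ} [W.IsElliptic]

/-- `χ(p)² = 1` at the odd primes, for a quadratic character `χ mod 8`. [folklore] -/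
theorem mul_self_apply_eq_one_of_isQuadratic_eight {χ : DirichletCharacter ℂ 8}
    (hχ : χ.IsQuadratic) {p : ℕ} (hp : p.Prime) (hp2 : ¬ p ∣ 2) : χ p * χ p = 1 := by
  have hp8 : ¬ p ∣ 8 := fun h ↦ hp2 (hp.dvd_of_dvd_pow (show p ∣ 2 ^ 3 by simpa using h))
  have hunit : IsUnit ((p : ℕ) : ZMod 8) := (ZMod.isUnit_prime_iff_not_dvd hp).mpr hp8
  rw [← sq]
  exact apply_sq_eq_one_of_isQuadratic hχ hunit

/-- **The levels of the newforms of `E` and of `E^{(2)}` divide `lcm(·, 64)` of each other**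
(`a_p(g) = χ₈(p) a_p(f)` and `a_p(f) = χ₈(p) a_p(g)` at the odd primes;
`level_dvd_lcm_sq_of_charTwist_packet` with `m = 8`, both ways). In particular the odd parts of the
levels agree and `v₂ ≤ 6` is where the `2`-parts may differ. [cite: AtkinLi1978, §3] -/
theorem _root_.Literature.NumberTheory.EllipticCurves.ModularForms.IsNewformOf.level_dvd_lcm_sixtyfour_of_quadraticTwist_two {f : CuspForm (Gamma0 N) 2}
    {g : CuspForm (Gamma0 N') 2} (hf : IsNewformOf W f) (hg : IsNewformOf (W.quadraticTwist 2) g) :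
    N ∣ Nat.lcm N' 64 ∧ N' ∣ Nat.lcm N 64 := by
  set χ : DirichletCharacter ℂ 8 := ZMod.χ₈.ringHomComp (Int.castRingHom ℂ) with hχ
  have hχq : χ.IsQuadratic := isQuadratic_χ₈_ringHomComp
  have hχp : χ.IsPrimitive := isPrimitive_χ₈_ringHomComp
  have hpk : ∀ p : ℕ, p.Prime → ¬ p ∣ 2 → cuspCoeff g p = χ p * cuspCoeff f p :=
    fun p hp hp2 ↦ hf.cuspCoeff_prime_eq_χ₈_mul hg p hp hp2
  have hpk' : ∀ p : ℕ, p.Prime → ¬ p ∣ 2 → cuspCoeff f p = χ p * cuspCoeff g p := by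
    intro p hp hp2
    rw [hpk p hp hp2, ← mul_assoc, mul_self_apply_eq_one_of_isQuadratic_eight hχq hp hp2,
      one_mul]
  have h1 : N ∣ Nat.lcm N' (8 ^ 2) :=
    level_dvd_lcm_sq_of_charTwist_packet hχq hχp hf.1 hg.1 hpk two_ne_zero
  have h2 : N' ∣ Nat.lcm N (8 ^ 2) :=
    level_dvd_lcm_sq_of_charTwist_packet hχq hχp hg.1 hf.1 hpk' two_ne_zero
  exact ⟨by simpa using h1, by simpa using h2⟩

/-- **The levels of the newforms of `E` and of `E^{(−2)}` divide `lcm(·, 64)` of each other**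
(character `χ₈'`). [cite: AtkinLi1978, §3] -/
theorem _root_.Literature.NumberTheory.EllipticCurves.ModularForms.IsNewformOf.level_dvd_lcm_sixtyfour_of_quadraticTwist_neg_two {f : CuspForm (Gamma0 N) 2}
    {g : CuspForm (Gamma0 N') 2} (hf : IsNewformOf W f) (hg : IsNewformOf (W.quadraticTwist (-2)) g) :
    N ∣ Nat.lcm N' 64 ∧ N' ∣ Nat.lcm N 64 := by
  set χ : DirichletCharacter ℂ 8 := ZMod.χ₈'.ringHomComp (Int.castRingHom ℂ) with hχ
  have hχq : χ.IsQuadratic := isQuadratic_χ₈'_ringHomComp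
  have hχp : χ.IsPrimitive := isPrimitive_χ₈'_ringHomComp
  have hpk : ∀ p : ℕ, p.Prime → ¬ p ∣ 2 → cuspCoeff g p = χ p * cuspCoeff f p :=
    fun p hp hp2 ↦ hf.cuspCoeff_prime_eq_χ₈'_mul hg p hp hp2
  have hpk' : ∀ p : ℕ, p.Prime → ¬ p ∣ 2 → cuspCoeff f p = χ p * cuspCoeff g p := by
    intro p hp hp2
    rw [hpk p hp hp2, ← mul_assoc, mul_self_apply_eq_one_of_isQuadratic_eight hχq hp hp2,
      one_mul]
  have h1 : N ∣ Nat.lcm N' (8 ^ 2) :=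
    level_dvd_lcm_sq_of_charTwist_packet hχq hχp hf.1 hg.1 hpk two_ne_zero
  have h2 : N' ∣ Nat.lcm N (8 ^ 2) :=
    level_dvd_lcm_sq_of_charTwist_packet hχq hχp hg.1 hf.1 hpk' two_ne_zero
  exact ⟨by simpa using h1, by simpa using h2⟩

/-- **The levels of the newforms of `E` and of its twist by `d ∈ {−1, 2, −2}` divide `lcm(·, 64)` of
each other** (for `d = −1` already `lcm(·, 16)`,
`IsNewformOf.level_dvd_lcm_sixteen_of_quadraticTwist_neg_one`). [cite: AtkinLi1978, §3] -/
theorem _root_.Literature.NumberTheory.EllipticCurves.ModularForms.IsNewformOf.level_dvd_lcm_sixtyfour_of_quadraticTwist {d : ℤ} (hd : d = -1 ∨ d = 2 ∨ d = -2)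
    {f : CuspForm (Gamma0 N) 2} {g : CuspForm (Gamma0 N') 2} (hf : IsNewformOf W f)
    (hg : IsNewformOf (W.quadraticTwist (d : ℚ)) g) :
    N ∣ Nat.lcm N' 64 ∧ N' ∣ Nat.lcm N 64 := by
  have hlcm : ∀ a : ℕ, Nat.lcm a 16 ∣ Nat.lcm a 64 := fun a ↦
    Nat.lcm_dvd (Nat.dvd_lcm_left a 64) ((show (16 : ℕ) ∣ 64 by norm_num).trans (Nat.dvd_lcm_right a 64))
  rcases hd with rfl | rfl | rfl
  · rw [show ((-1 : ℤ) : ℚ) = -1 by norm_num] at hg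
    obtain ⟨h1, h2⟩ := hf.level_dvd_lcm_sixteen_of_quadraticTwist_neg_one hg
    exact ⟨h1.trans (hlcm N'), h2.trans (hlcm N)⟩
  · rw [show ((2 : ℤ) : ℚ) = 2 by norm_num] at hg
    exact hf.level_dvd_lcm_sixtyfour_of_quadraticTwist_two hg
  · rw [show ((-2 : ℤ) : ℚ) = -2 by norm_num] at hg
    exact hf.level_dvd_lcm_sixtyfour_of_quadraticTwist_neg_two hg

/-- `N' ∣ lcm(N, 64)` gives `N' ≤ 64 N`. [folklore] -/
theorem le_sixtyfour_mul_of_dvd_lcm {N N' : ℕ} (hN : N ≠ 0) (h : N' ∣ Nat.lcm N 64) : N' ≤ 64 * N := by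
  have h' : N' ∣ N * 64 := h.trans (Nat.lcm_dvd_mul N 64)
  have := Nat.le_of_dvd (Nat.pos_of_ne_zero (mul_ne_zero hN (by norm_num))) h'
  linarith

/-- An odd prime square dividing `N' ∣ lcm(N, 64)` divides `N`. [folklore] -/
theorem sq_dvd_of_sq_dvd_of_dvd_lcm_sixtyfour {N N' p : ℕ} (hp : p.Prime) (hp2 : p ≠ 2)
    (h : N' ∣ Nat.lcm N 64) (hsq : p ^ 2 ∣ N') : p ^ 2 ∣ N := by
  have h' : p ^ 2 ∣ N * 64 := hsq.trans (h.trans (Nat.lcm_dvd_mul N 64))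
  have hcop : (p ^ 2).Coprime 64 := by
    rw [show (64 : ℕ) = 2 ^ 6 by norm_num]
    exact Nat.Coprime.pow _ _ ((Nat.coprime_primes hp Nat.prime_two).mpr hp2)
  exact hcop.dvd_of_dvd_mul_right h'

/-- `ψ(64 n) ≤ 96 ψ(n)`: with `n = 2^e n₁`, `n₁` odd, `ψ(2^{e+6}) = 3 · 2^{e+5}` is `96 ψ(2^e)` for
`e = 0` and `64 ψ(2^e)` for `e ≥ 1`. [folklore] -/
theorem gamma0Index_sixtyfour_mul_le {n : ℕ} (hn : n ≠ 0) :
    gamma0Index (64 * n) ≤ 96 * gamma0Index n := by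
  obtain ⟨e, n₁, hn₁, rfl⟩ := Nat.exists_eq_two_pow_mul_odd hn
  have hcop : ∀ j : ℕ, Nat.Coprime (2 ^ j) n₁ := fun j ↦
    (Nat.coprime_pow_left_iff (n := j + 1) j.succ_pos _ _).mp
      ((Nat.coprime_pow_left_iff j.succ_pos _ _).mpr (Nat.Coprime.pow_left _
        ((Nat.prime_two.coprime_iff_not_dvd).mpr hn₁.not_two_dvd_nat)))
  have h64 : 64 * (2 ^ e * n₁) = 2 ^ (e + 6) * n₁ := by ring
  rw [h64, gamma0Index_mul (hcop (e + 6)), gamma0Index_mul (hcop e),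
    gamma0Index_prime_pow Nat.prime_two (Nat.succ_ne_zero _), ← mul_assoc]
  refine Nat.mul_le_mul_right _ ?_
  rcases Nat.eq_zero_or_pos e with rfl | he
  · simp [gamma0Index]
  · rw [gamma0Index_prime_pow Nat.prime_two he.ne']
    have : 2 ^ (e + 6 - 1) = 64 * 2 ^ (e - 1) := by
      rw [show e + 6 - 1 = (e - 1) + 6 by omega, pow_add]
      ring
    rw [this]
    nlinarith [Nat.one_le_two_pow (n := e - 1)]

/-- `N ∣ lcm(N', 64)` gives `ψ(N) ≤ 96 ψ(N')`. [folklore] -/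
theorem gamma0Index_le_of_dvd_lcm_sixtyfour {N N' : ℕ} (hN' : N' ≠ 0) (h : N ∣ Nat.lcm N' 64) :
    gamma0Index N ≤ 96 * gamma0Index N' :=
  ((gamma0Index_le_of_dvd h (Nat.lcm_ne_zero hN' (by norm_num))).trans
    (gamma0Index_le_of_dvd (Nat.lcm_dvd_mul N' 64) (mul_ne_zero hN' (by norm_num)))).trans
    (by rw [mul_comm N' 64]; exact gamma0Index_sixtyfour_mul_le hN')

end Level

/-! ### The descent: `(f, f) ≪ N (log N)³` at every level whose twist by `−1`, `2` or `−2` has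
`64 ∤` level -/

section Main

variable {N N₁ : ℕ} [NeZero N] [NeZero N₁] {W : WeierstrassCurve ℚ} [W.IsElliptic]

/-- `d ∈ {−1, 2, −2}` is non-zero in `ℚ`. [folklore] -/
theorem ratCast_ne_zero_of_mem {d : ℤ} (hd : d = -1 ∨ d = 2 ∨ d = -2) : (d : ℚ) ≠ 0 := by
  rcases hd with rfl | rfl | rfl <;> norm_num

/-- **`Re (f, f) ≤ 1536 · Re (g, g)`** for the newform `f` of `E` (level `N`) and the newform `g` of
its twist by `d ∈ {−1, 2, −2}` (level `N₁`): `ψ(N₁) Re(f,f) ≤ 16 ψ(N) Re(g,g)`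
(`IsNewformOf.gamma0Index_mul_re_petersson_le_sixteen_mul`) and `ψ(N) ≤ 96 ψ(N₁)` since
`N ∣ lcm(N₁, 64)` (`IsNewformOf.level_dvd_lcm_sixtyfour_of_quadraticTwist`).
[cite: HoffsteinLockhart1994, Thm. 0.1 (proof, the twist-equivalent case)] [cite: AtkinLi1978, §3] -/
theorem _root_.Literature.NumberTheory.EllipticCurves.ModularForms.IsNewformOf.re_petersson_le_of_quadraticTwist_mem
    {d : ℤ} (hd : d = -1 ∨ d = 2 ∨ d = -2) {f : CuspForm (Gamma0 N) 2} {g : CuspForm (Gamma0 N₁) 2}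
    (hf : IsNewformOf W f) (hg : IsNewformOf (W.quadraticTwist (d : ℚ)) g) :
    (peterssonProduct (Gamma0 N) 2 f f).re ≤ 1536 * (peterssonProduct (Gamma0 N₁) 2 g g).re := by
  have hcmp := hf.gamma0Index_mul_re_petersson_le_sixteen_mul hd hg
  obtain ⟨hN, -⟩ := hf.level_dvd_lcm_sixtyfour_of_quadraticTwist hd hg
  have hψ : (gamma0Index N : ℝ) ≤ 96 * gamma0Index N₁ := by
    exact_mod_cast gamma0Index_le_of_dvd_lcm_sixtyfour (NeZero.ne N₁) hN
  have hψN₁ : (0 : ℝ) < gamma0Index N₁ := Nat.cast_pos.mpr (gamma0Index_pos N₁)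
  have hPg : 0 ≤ (peterssonProduct (Gamma0 N₁) 2 g g).re := hg.peterssonProduct_re_pos.le
  have h2 : (gamma0Index N₁ : ℝ) * (peterssonProduct (Gamma0 N) 2 f f).re ≤
      gamma0Index N₁ * (1536 * (peterssonProduct (Gamma0 N₁) 2 g g).re) :=
    calc (gamma0Index N₁ : ℝ) * (peterssonProduct (Gamma0 N) 2 f f).re
        ≤ 16 * gamma0Index N * (peterssonProduct (Gamma0 N₁) 2 g g).re := hcmp
      _ ≤ 16 * (96 * gamma0Index N₁) * (peterssonProduct (Gamma0 N₁) 2 g g).re := by gcongr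
      _ = gamma0Index N₁ * (1536 * (peterssonProduct (Gamma0 N₁) 2 g g).re) := by ring
  exact le_of_mul_le_mul_left h2 hψN₁

/-- `1 + log N₁ ≤ (1 + log 64)(1 + log N)` for `1 ≤ N₁ ≤ 64 N`. [folklore] -/
theorem one_add_log_le_of_le_sixtyfour_mul {x y : ℝ} (hx : 1 ≤ x) (hy : 1 ≤ y) (h : y ≤ 64 * x) :
    1 + Real.log y ≤ (1 + Real.log 64) * (1 + Real.log x) := by
  have hlx : 0 ≤ Real.log x := Real.log_nonneg hx
  have hl64 : 0 ≤ Real.log 64 := Real.log_nonneg (by norm_num)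
  have hly : Real.log y ≤ Real.log 64 + Real.log x := by
    rw [← Real.log_mul (by norm_num) (by linarith)]
    exact Real.log_le_log (by linarith) h
  nlinarith

/-- **Mai–Murty's `(f, f) ≪ N (log N)³` descends along a quadratic twist by `−1`, `2` or `−2`.**
There is an absolute `C > 0` such that: for `d ∈ {−1, 2, −2}`, every level `N` with `p² ∤ N` for all
odd primes `p`, every elliptic curve `E/ℚ` with newform `f ∈ S₂(Γ₀(N))`, any newform `g ∈ S₂(Γ₀(N₁))`
of the twist `E^{(d)}` **with `64 ∤ N₁`**, and any newform `h` of `(E^{(d)})^{(−1)}` (at any level),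
`Re (f, f)_{Γ₀(N)} ≤ C · N · (1 + log N)³`.
Proof: `N₁ ∣ lcm(N, 64)` has squarefree odd part and `64 ∤ N₁`, so the tree's theorem for the levels
`2ᵗM`, `t ≤ 5` (`exists_petersson_le_mul_log_cube_of_not_sixtyfour_dvd'`, the statement the printed
proof of `murty_petersson_newform_upper_bound` establishes: Mai–Murty 1994, §2, Rademacher's
Phragmén–Lindelöf for the Rankin–Selberg convolution) bounds `Re (g, g) ≤ C₀ N₁ (1 + log N₁)³`; then
`Re (f, f) ≤ 1536 Re (g, g)` (`IsNewformOf.re_petersson_le_of_quadraticTwist_mem`: the Rankin–Selberg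
residues of `f` and `g` agree up to the local factors at `2` and the index, Rankin 1939 /
Hoffstein–Lockhart 1994) and `N₁ ≤ 64 N`. This covers every conductor `2ᵗM` (`M` odd squarefree)
whose local type at `2` is a twist by `χ₋₄`, `χ₈` or `χ₋₈` of a type of conductor `≤ 2⁵` (e.g. all
principal-series and special types with `t = 6`), but not the types with `t ∈ {7, 8}` that keep
conductor `≥ 2⁶` under these twists (all types with `t = 8`, the dihedral ones with `t = 7`). [cite: MaiMurty1994, §2, Proposition] [cite: HoffsteinLockhart1994, Thm. 0.1 (proof, the twist-equivalent case)]
[cite: AtkinLi1978, §3] -/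
theorem exists_petersson_le_mul_log_cube_of_quadraticTwist_not_sixtyfour_dvd :
    ∃ C : ℝ, 0 < C ∧ ∀ (d : ℤ), (d = -1 ∨ d = 2 ∨ d = -2) →
      ∀ (N N₁ N₂ : ℕ) [NeZero N] [NeZero N₁] [NeZero N₂], ¬ 64 ∣ N₁ →
      (∀ p : ℕ, p.Prime → p ≠ 2 → ¬ p ^ 2 ∣ N) →
      ∀ (W : WeierstrassCurve ℚ) [W.IsElliptic] (f : CuspForm (Gamma0 N) 2)
        (g : CuspForm (Gamma0 N₁) 2) (h : CuspForm (Gamma0 N₂) 2),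
        IsNewformOf W f → IsNewformOf (W.quadraticTwist (d : ℚ)) g →
        IsNewformOf ((W.quadraticTwist (d : ℚ)).quadraticTwist (-1)) h →
        (peterssonProduct (Gamma0 N) 2 f f).re ≤ C * N * (1 + Real.log N) ^ 3 := by
  obtain ⟨C₀, hC₀, h5⟩ := exists_petersson_le_mul_log_cube_of_not_sixtyfour_dvd'
  have hl64 : 0 ≤ Real.log 64 := Real.log_nonneg (by norm_num)
  refine ⟨1536 * (C₀ * 64 * (1 + Real.log 64) ^ 3), by positivity, ?_⟩
  intro d hd N N₁ N₂ _ _ _ h64 hodd W _ f g h hf hg hh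
  haveI := W.isElliptic_quadraticTwist (ratCast_ne_zero_of_mem hd)
  -- the level of `g`: squarefree odd part, `N₁ ≤ 64 N`
  obtain ⟨-, hN₁⟩ := hf.level_dvd_lcm_sixtyfour_of_quadraticTwist hd hg
  have hodd₁ : ∀ p : ℕ, p.Prime → p ≠ 2 → ¬ p ^ 2 ∣ N₁ := fun p hp hp2 hsq ↦
    hodd p hp hp2 (sq_dvd_of_sq_dvd_of_dvd_lcm_sixtyfour hp hp2 hN₁ hsq)
  have hN₁le : (N₁ : ℝ) ≤ 64 * N := by
    exact_mod_cast le_sixtyfour_mul_of_dvd_lcm (NeZero.ne N) hN₁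
  have hN1 : (1 : ℝ) ≤ N := by exact_mod_cast NeZero.one_le (n := N)
  have hN₁1 : (1 : ℝ) ≤ N₁ := by exact_mod_cast NeZero.one_le (n := N₁)
  have hlN : 0 ≤ 1 + Real.log N := by
    have := Real.log_nonneg hN1
    linarith
  -- the bound for `g` and the comparison
  have hg_bd := h5 N₁ N₂ h64 hodd₁ (W.quadraticTwist (d : ℚ)) g h hg hh
  have hcmp := hf.re_petersson_le_of_quadraticTwist_mem hd hg
  have hlog := one_add_log_le_of_le_sixtyfour_mul hN1 hN₁1 hN₁le
  have hlog0 : 0 ≤ 1 + Real.log N₁ := by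
    have := Real.log_nonneg hN₁1
    linarith
  calc (peterssonProduct (Gamma0 N) 2 f f).re
      ≤ 1536 * (peterssonProduct (Gamma0 N₁) 2 g g).re := hcmp
    _ ≤ 1536 * (C₀ * N₁ * (1 + Real.log N₁) ^ 3) := by gcongr
    _ ≤ 1536 * (C₀ * (64 * N) * ((1 + Real.log 64) * (1 + Real.log N)) ^ 3) := by gcongr
    _ = 1536 * (C₀ * 64 * (1 + Real.log 64) ^ 3) * N * (1 + Real.log N) ^ 3 := by ring

/-- **Power form** of `exists_petersson_le_mul_log_cube_of_quadraticTwist_not_sixtyfour_dvd` (the shape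
consumed by the `abc` routes): `Re (f, f) ≤ C · N^{1+ε}/ε³` for `0 < ε ≤ 1`.
[cite: MaiMurty1994, §2, Proposition] -/
theorem exists_petersson_le_mul_rpow_of_quadraticTwist_not_sixtyfour_dvd :
    ∃ C : ℝ, 0 < C ∧ ∀ ε : ℝ, 0 < ε → ε ≤ 1 → ∀ (d : ℤ), (d = -1 ∨ d = 2 ∨ d = -2) →
      ∀ (N N₁ N₂ : ℕ) [NeZero N] [NeZero N₁] [NeZero N₂], ¬ 64 ∣ N₁ →
      (∀ p : ℕ, p.Prime → p ≠ 2 → ¬ p ^ 2 ∣ N) →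
      ∀ (W : WeierstrassCurve ℚ) [W.IsElliptic] (f : CuspForm (Gamma0 N) 2)
        (g : CuspForm (Gamma0 N₁) 2) (h : CuspForm (Gamma0 N₂) 2),
        IsNewformOf W f → IsNewformOf (W.quadraticTwist (d : ℚ)) g →
        IsNewformOf ((W.quadraticTwist (d : ℚ)).quadraticTwist (-1)) h →
        (peterssonProduct (Gamma0 N) 2 f f).re ≤ C * (N : ℝ) ^ (1 + ε) / ε ^ 3 := by
  obtain ⟨C, hC, hmain⟩ := exists_petersson_le_mul_log_cube_of_quadraticTwist_not_sixtyfour_dvd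
  refine ⟨C * 4 ^ 3, by positivity, ?_⟩
  intro ε hε hε1 d hd N N₁ N₂ _ _ _ h64 hodd W _ f g h hf hg hh
  have hN1 : (1 : ℝ) ≤ N := by exact_mod_cast NeZero.one_le (n := N)
  calc (peterssonProduct (Gamma0 N) 2 f f).re ≤ C * N * (1 + Real.log N) ^ 3 :=
        hmain d hd N N₁ N₂ h64 hodd W f g h hf hg hh
    _ = C * (N * (1 + Real.log N) ^ 3) := by ring
    _ ≤ C * (4 ^ 3 * (N : ℝ) ^ (1 + ε) / ε ^ 3) :=
        mul_le_mul_of_nonneg_left (mul_one_add_log_pow_three_le_rpow hN1 hε hε1) hC.le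
    _ = C * 4 ^ 3 * (N : ℝ) ^ (1 + ε) / ε ^ 3 := by ring

/-- **Logarithmic form**: `log Re (f, f) ≤ log N + 3 log (1 + log N) + log C` under the hypotheses
of `exists_petersson_le_mul_log_cube_of_quadraticTwist_not_sixtyfour_dvd` (Pasten's use of the named
fact, arXiv:1705.09251, §16 p. 49: "`2 log ‖f‖ ≤ log N + O(log log N)`").
[cite: PastenShimura2024, §16 p. 49] [cite: MaiMurty1994, §2, Proposition] -/
theorem exists_log_petersson_le_of_quadraticTwist_not_sixtyfour_dvd :
    ∃ C : ℝ, ∀ (d : ℤ), (d = -1 ∨ d = 2 ∨ d = -2) →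
      ∀ (N N₁ N₂ : ℕ) [NeZero N] [NeZero N₁] [NeZero N₂], ¬ 64 ∣ N₁ →
      (∀ p : ℕ, p.Prime → p ≠ 2 → ¬ p ^ 2 ∣ N) →
      ∀ (W : WeierstrassCurve ℚ) [W.IsElliptic] (f : CuspForm (Gamma0 N) 2)
        (g : CuspForm (Gamma0 N₁) 2) (h : CuspForm (Gamma0 N₂) 2),
        IsNewformOf W f → IsNewformOf (W.quadraticTwist (d : ℚ)) g →
        IsNewformOf ((W.quadraticTwist (d : ℚ)).quadraticTwist (-1)) h →
        Real.log (peterssonProduct (Gamma0 N) 2 f f).re ≤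
          Real.log N + 3 * Real.log (1 + Real.log N) + C := by
  obtain ⟨C, hC, hmain⟩ := exists_petersson_le_mul_log_cube_of_quadraticTwist_not_sixtyfour_dvd
  refine ⟨Real.log C, fun d hd N N₁ N₂ _ _ _ h64 hodd W _ f g h hf hg hh ↦ ?_⟩
  have hN0 : (0 : ℝ) < N := Nat.cast_pos.mpr (NeZero.pos N)
  have hN1 : (1 : ℝ) ≤ N := by exact_mod_cast NeZero.one_le (n := N)
  have hl : 0 < 1 + Real.log N := by
    have := Real.log_nonneg hN1
    linarith
  have hpos : 0 < (peterssonProduct (Gamma0 N) 2 f f).re := hf.peterssonProduct_re_pos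
  have hb := hmain d hd N N₁ N₂ h64 hodd W f g h hf hg hh
  calc Real.log (peterssonProduct (Gamma0 N) 2 f f).re
      ≤ Real.log (C * N * (1 + Real.log N) ^ 3) := Real.log_le_log hpos hb
    _ = Real.log N + 3 * Real.log (1 + Real.log N) + Real.log C := by
        rw [Real.log_mul (by positivity) (by positivity), Real.log_mul hC.ne' hN0.ne',
          Real.log_pow]
        push_cast
        ring

end Main

/-! ### Under the Modularity Theorem: the bound for every curve with squarefree odd conductor whose
twist-orbit under `⟨χ₋₄, χ₈⟩` meets a conductor with `64 ∤` -/

section Modularity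

/-- **Mai–Murty's `(f, f) ≪ N (log N)³` for every elliptic curve over `ℚ` whose conductor has
squarefree odd part and such that `E` or one of its twists `E^{(−1)}`, `E^{(2)}`, `E^{(−2)}` has
conductor not divisible by `64`, from the Modularity Theorem** (`exists_isNewformOf`, supplying the
newforms of the twists at level = conductor).  There is an absolute `C > 0` with
`Re (f, f)_{Γ₀(N)} ≤ C · N · (1 + log N)³` for the newform `f ∈ S₂(Γ₀(N))` of every such `E`
(`N` any level carrying `IsNewformOf E f`; it is the conductor, Carayol). Assembles
`exists_petersson_le_mul_log_cube_of_not_sixtyfour_dvd'` (`64 ∤ N`) and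
`exists_petersson_le_mul_log_cube_of_quadraticTwist_not_sixtyfour_dvd` (`64 ∤ N_{E^{(d)}}`).
[cite: MaiMurty1994, §2, Proposition] [cite: BreuilConradDiamondTaylor2001, Thm. A] -/
theorem exists_petersson_le_mul_log_cube_of_exists_isNewformOf (hmod : exists_isNewformOf) :
    ∃ C : ℝ, 0 < C ∧ ∀ (N : ℕ) [NeZero N] (W : WeierstrassCurve ℚ) [W.IsElliptic]
      (f : CuspForm (Gamma0 N) 2), IsNewformOf W f →
      (∀ p : ℕ, p.Prime → p ≠ 2 → ¬ p ^ 2 ∣ N) →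
      (¬ 64 ∣ N ∨ ∃ d : ℤ, (d = -1 ∨ d = 2 ∨ d = -2) ∧
        ¬ 64 ∣ (W.quadraticTwist (d : ℚ)).conductorNorm ℤ) →
      (peterssonProduct (Gamma0 N) 2 f f).re ≤ C * N * (1 + Real.log N) ^ 3 := by
  obtain ⟨C₅, hC₅, h5⟩ := exists_petersson_le_mul_log_cube_of_not_sixtyfour_dvd'
  obtain ⟨C₆, hC₆, h6⟩ := exists_petersson_le_mul_log_cube_of_quadraticTwist_not_sixtyfour_dvd
  refine ⟨max C₅ C₆, lt_max_of_lt_left hC₅, ?_⟩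
  intro N _ W _ f hf hodd hcase
  have hN1 : (1 : ℝ) ≤ N := by exact_mod_cast NeZero.one_le (n := N)
  have hfac : 0 ≤ (N : ℝ) * (1 + Real.log N) ^ 3 := by
    have := Real.log_nonneg hN1
    positivity
  rcases hcase with h64 | ⟨d, hd, h64⟩
  · -- `64 ∤ N`: the newform of `E^{(−1)}` from modularity
    haveI := W.isElliptic_quadraticTwist (show ((-1 : ℚ)) ≠ 0 by norm_num)
    haveI : NeZero ((W.quadraticTwist (-1)).conductorNorm ℤ) :=
      ⟨(WeierstrassCurve.conductorNorm_pos_holds (W.quadraticTwist (-1))).ne'⟩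
    obtain ⟨g, hg⟩ := hmod (W.quadraticTwist (-1))
    calc (peterssonProduct (Gamma0 N) 2 f f).re ≤ C₅ * N * (1 + Real.log N) ^ 3 :=
          h5 N _ h64 hodd W f g hf hg
      _ = C₅ * (N * (1 + Real.log N) ^ 3) := by ring
      _ ≤ max C₅ C₆ * (N * (1 + Real.log N) ^ 3) :=
          mul_le_mul_of_nonneg_right (le_max_left _ _) hfac
      _ = max C₅ C₆ * N * (1 + Real.log N) ^ 3 := by ring
  · -- `64 ∤ N_{E^{(d)}}`: the newforms of `E^{(d)}` and `(E^{(d)})^{(−1)}` from modularity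
    haveI := W.isElliptic_quadraticTwist (ratCast_ne_zero_of_mem hd)
    haveI := (W.quadraticTwist (d : ℚ)).isElliptic_quadraticTwist (show ((-1 : ℚ)) ≠ 0 by norm_num)
    haveI : NeZero ((W.quadraticTwist (d : ℚ)).conductorNorm ℤ) :=
      ⟨(WeierstrassCurve.conductorNorm_pos_holds (W.quadraticTwist (d : ℚ))).ne'⟩
    haveI : NeZero (((W.quadraticTwist (d : ℚ)).quadraticTwist (-1)).conductorNorm ℤ) :=
      ⟨(WeierstrassCurve.conductorNorm_pos_holds ((W.quadraticTwist (d : ℚ)).quadraticTwist (-1))).ne'⟩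
    obtain ⟨g, hg⟩ := hmod (W.quadraticTwist (d : ℚ))
    obtain ⟨h, hh⟩ := hmod ((W.quadraticTwist (d : ℚ)).quadraticTwist (-1))
    calc (peterssonProduct (Gamma0 N) 2 f f).re ≤ C₆ * N * (1 + Real.log N) ^ 3 :=
          h6 d hd N _ _ h64 hodd W f g h hf hg hh
      _ = C₆ * (N * (1 + Real.log N) ^ 3) := by ring
      _ ≤ max C₅ C₆ * (N * (1 + Real.log N) ^ 3) :=
          mul_le_mul_of_nonneg_right (le_max_right _ _) hfac
      _ = max C₅ C₆ * N * (1 + Real.log N) ^ 3 := by ring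

/-- **Power form** of `exists_petersson_le_mul_log_cube_of_exists_isNewformOf`:
`Re (f, f) ≤ C · N^{1+ε}/ε³` for `0 < ε ≤ 1`. [cite: MaiMurty1994, §2, Proposition] -/
theorem exists_petersson_le_mul_rpow_of_exists_isNewformOf (hmod : exists_isNewformOf) :
    ∃ C : ℝ, 0 < C ∧ ∀ ε : ℝ, 0 < ε → ε ≤ 1 → ∀ (N : ℕ) [NeZero N] (W : WeierstrassCurve ℚ) [W.IsElliptic]
      (f : CuspForm (Gamma0 N) 2), IsNewformOf W f →
      (∀ p : ℕ, p.Prime → p ≠ 2 → ¬ p ^ 2 ∣ N) →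
      (¬ 64 ∣ N ∨ ∃ d : ℤ, (d = -1 ∨ d = 2 ∨ d = -2) ∧
        ¬ 64 ∣ (W.quadraticTwist (d : ℚ)).conductorNorm ℤ) →
      (peterssonProduct (Gamma0 N) 2 f f).re ≤ C * (N : ℝ) ^ (1 + ε) / ε ^ 3 := by
  obtain ⟨C, hC, hmain⟩ := exists_petersson_le_mul_log_cube_of_exists_isNewformOf hmod
  refine ⟨C * 4 ^ 3, by positivity, ?_⟩
  intro ε hε hε1 N _ W _ f hf hodd hcase
  have hN1 : (1 : ℝ) ≤ N := by exact_mod_cast NeZero.one_le (n := N)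
  calc (peterssonProduct (Gamma0 N) 2 f f).re ≤ C * N * (1 + Real.log N) ^ 3 :=
        hmain N W f hf hodd hcase
    _ = C * (N * (1 + Real.log N) ^ 3) := by ring
    _ ≤ C * (4 ^ 3 * (N : ℝ) ^ (1 + ε) / ε ^ 3) :=
        mul_le_mul_of_nonneg_left (mul_one_add_log_pow_three_le_rpow hN1 hε hε1) hC.le
    _ = C * 4 ^ 3 * (N : ℝ) ^ (1 + ε) / ε ^ 3 := by ring

end Modularity

end Literature.NumberTheory.Automorphic

end
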